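import Literature.NumberTheory.ComplexMultiplication.CommonAbelianCMSubfieldDegenerate
import Literature.AlgebraicGeometry.Pohlmann1968.SeparatingCMFamilies
import Summits.HodgeConjecture.CorCM.PairwisePartialConjCMHodge
import Summits.HodgeConjecture.CorCM.CyclotomicSliceSubdegree
import HarnessLib

/-!
# ABELIAN CM fields: a family of CM types is nondegenerate iff its members are nondegenerate and the fields pairwise
# meet in TOTALLY REAL fields — the Hodge conjecture on all products, or an exceptional Hodge class

COR-CM (cell `pub-hodgecm2`, binder seat `b23` gen 29, lane ODDCHAR F3), count-neutral; NEW as stated, hence under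
`Summits/`.  Theorems only; no definition, no named fact, no `sorry`.

Setting: CM fields `K_i` (`i ∈ I` finite) which are ABELIAN extensions of `ℚ` (Galois with commutative Galois group,
Mathlib's `IsAbelianGalois`: cyclotomic fields `ℚ(ζ_N)`, their CM subfields, `ℚ(√−1, √2)`, …), CM types `Φ_i`, Galois
closures `L_i = normalClosure ℚ K_i ℂ = φ(K_i)` for every embedding `φ`.  For such fields the pairwise intersections
`L_i ∩ L_j` (again abelian) are either totally real or CM, and complex conjugation is a CENTRAL element of every Galois
group in sight, visible to the characters.  The two directions:

* (⟸, any CM fields) pairwise, complex conjugation fixes `L_i ∩ L_j` pointwise ⟹ a pairwise partial conjugation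
  (`exists_pairConj_of_conj_apply_eq`, this seat's `forall_exists_partialConj_pair`) ⟹ no common constituent
  (p2's `pairwise_of_partialConj` / `isNondegenerateFamily_iff_of_menu₂`) ⟹ rank additive, family nondegenerate iff members
  are: **`isNondegenerateFamily_iff_forall_of_pairwise_conj_apply_eq`**, `cmFamilyRank_add_card_eq_of_pairwise_conj_apply_eq`
  — BY NAME, for ARBITRARY CM fields;
* (⟹, abelian fields) if `L_{i₀} ∩ L_{i₁}` contains a non-real element, it is a finite normal subfield of `ℂ` on which
  `Aut(ℂ)` acts through the abelian group `Gal(L_{i₀}/ℚ)` and which conjugation moves, so it carries an ODD character of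
  `Aut(ℂ)` (`exists_oddChar_of_abelian`), and two NONDEGENERATE members `Φ_{i₀}`, `Φ_{i₁}` make the family degenerate
  (`not_isNondegenerateFamily_of_common_subfield`, lane ODDCHAR F1/F2): **`not_isNondegenerateFamily_of_abelian_of_conj_apply_ne`**.

Hence **`isNondegenerateFamily_iff_of_abelian`**: for abelian CM fields,
`IsNondegenerateFamily Φ ⟺ (∀ i, IsNondegenerate Φ_i) ∧ ∀ i ≠ j, conj fixes L_i ∩ L_j pointwise` — Kubota's Lemma 2 for
FAMILIES in field-theoretic form.  Geometry, for every family of realisations `A_i` of the `(K_i; Φ_i)`: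
**`hodgeConjectureFor_prod_of_abelian`** (the Hodge conjecture and `B• = D•` on every `∏_i A_i^{k_i}` when the members are
nondegenerate and the intersections real), and for SIMPLE pairwise NON-ISOGENOUS `A_i` with nondegenerate types the
dichotomy **`exists_exceptional_prod_iff_of_abelian`**: some product carries an exceptional Hodge class iff two of the
fields meet in a field that is not totally real (e.g. `ℚ(ζ_5)`- and `ℚ(ζ_15)`-CM factors: always exceptional classes;
`ℚ(ζ_7)` and `ℚ(ζ_9)`: never), with the cyclotomic instances **`not_isNondegenerateFamily_of_isCyclotomicExtension_of_dvd`**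
/ **`exists_exceptional_prod_of_isCyclotomicExtension_of_dvd`** (levels with a common divisor `d ≥ 3`: `ℚ(ζ_d)` is a common
abelian CM subfield).  Special cases in the tree: imaginary quadratic fields (`QuadraticCMFamilies*`), Galois
fields of degree `2·odd` (`TwiceOddDegreeCMFamiliesHodge`), coprime cyclotomic levels (`IndependentCMFieldsHodge`).

## References

* [Kubota1965] T. Kubota, *On the field extension by complex multiplication*, Trans. AMS 118 (1965), §4 Lemma 2.
* [Gordon1999HodgeAVSurvey] B. B. Gordon, *A survey of the Hodge conjecture for abelian varieties*, §3 Theorem (Imai,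
  Murty) and proof, 7.5–7.7 (Murty, Hazama), 9.4.1, 10.10.
* [Deligne1982HodgeCycles] P. Deligne, *Hodge cycles on abelian varieties*, LNM 900 (1982), I Ex. 3.7, §4.
-/

noncomputable section

open CategoryTheory CategoryTheory.Limits NumberField NumberField.ComplexEmbedding IntermediateField Module
open scoped BigOperators

namespace Summit.HodgeConjecture.CorCM

open Literature.NumberTheory.ComplexMultiplication
open Literature.AlgebraicGeometry.Motives (AbelianVariety CMType)
open Literature.AlgebraicGeometry.HodgeTheory
open Literature.AlgebraicGeometry.ComplexMultiplication (IsCMTypeRealisation)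
open Literature.AlgebraicGeometry.VanGeemen1994 (hodgeClassSpan)
open Literature.AlgebraicGeometry.Pohlmann1968
open Literature.Barriers.HodgeConjecture (divisorClassesSpan)

section Fields

variable {I : Type} {K : I → Type} [∀ i, Field (K i)] [∀ i, NumberField (K i)] [∀ i, IsCMField (K i)] [Fintype I]
  [DecidableEq I] [Nonempty I]

/-- **(⟸) for arbitrary CM fields: pairwise real intersections ⟹ nondegenerate iff members nondegenerate.**  If for all
`i ≠ j` complex conjugation fixes `L_i ∩ L_j` pointwise, every ordered pair of slots carries a pairwise partial
conjugation, and the family `(Φ_i)_i` is nondegenerate iff every `Φ_i` is (p2's second menu with every slot in the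
block `B`). [cite: Gordon1999HodgeAVSurvey, §3 Theorem and 7.5] -/
theorem isNondegenerateFamily_iff_forall_of_pairwise_conj_apply_eq (Φ : ∀ i, CMType (K i))
    (hreal : ∀ i j, i ≠ j → ∀ x : ℂ, x ∈ normalClosure ℚ (K i) ℂ → x ∈ normalClosure ℚ (K j) ℂ →
      starRingEnd ℂ x = x) :
    CMAlgebra.IsNondegenerateFamily Φ ↔ ∀ i, IsNondegenerate (Φ i) := by
  rw [isNondegenerateFamily_iff_of_menu₂ (fun _ => True) Φ (fun _ hj => (hj trivial).elim)
    (fun _ _ hi => (hi trivial).elim) (fun a b _ hab => exists_pairConj_of_conj_apply_eq hab (hreal a b hab))]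
  exact ⟨fun h i => h i trivial, fun h i _ => h i⟩

/-- **(⟸) at the rank level**: pairwise real intersections ⟹ `cmFamilyRank Φ + |I| = Σ_i cmTypeRank Φ_i + 1`
(`Hg(∏_i A_{Φ_i}) = ∏_i Hg(A_{Φ_i})`), for ALL CM types. [cite: Gordon1999HodgeAVSurvey, §3 Theorem (1)] -/
theorem cmFamilyRank_add_card_eq_of_pairwise_conj_apply_eq (Φ : ∀ i, CMType (K i))
    (hreal : ∀ i j, i ≠ j → ∀ x : ℂ, x ∈ normalClosure ℚ (K i) ℂ → x ∈ normalClosure ℚ (K j) ℂ →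
      starRingEnd ℂ x = x) :
    CMAlgebra.cmFamilyRank Φ + Fintype.card I = (∑ i, cmTypeRank (Φ i)) + 1 :=
  cmFamilyRank_add_card_eq_of_pairwise Φ (pairwise_of_menu₂ (fun _ => True) Φ (fun _ hj => (hj trivial).elim)
    (fun _ _ hi => (hi trivial).elim) (fun a b _ hab => exists_pairConj_of_conj_apply_eq hab (hreal a b hab)))

omit [DecidableEq I] in
/-- A subfield of a finite extension inside `ℂ` is finite. [folklore] -/
private theorem finiteDimensional_of_le''' {E E' : IntermediateField ℚ ℂ} [FiniteDimensional ℚ E] (h : E' ≤ E) :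
    FiniteDimensional ℚ E' :=
  FiniteDimensional.of_injective (IntermediateField.inclusion h).toLinearMap (IntermediateField.inclusion_injective h)

omit [DecidableEq I] in
/-- **(⟹) for ABELIAN fields: a non-real element of `L_{i₀} ∩ L_{i₁}` and two nondegenerate members force degeneracy.**
If `K_{i₀}`, `K_{i₁}` (`i₀ ≠ i₁`) are abelian extensions of `ℚ`, `Φ_{i₀}`, `Φ_{i₁}` are nondegenerate and some
`x ∈ L_{i₀} ∩ L_{i₁}` has `x̄ ≠ x`, then `cmFamilyRank Φ + |I| < Σ_i cmTypeRank Φ_i + 1` and `Φ` is DEGENERATE: the finite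
normal field `L_{i₀} ∩ L_{i₁}` has commuting `ℂ`-automorphisms and carries an odd character of `Aut(ℂ)`.
[cite: Kubota1965, §4 Lemma 2] [cite: Gordon1999HodgeAVSurvey, §3 Theorem (proof) and 7.5–7.7] -/
theorem not_isNondegenerateFamily_of_abelian_of_conj_apply_ne {i₀ i₁ : I} (h01 : i₀ ≠ i₁)
    [IsAbelianGalois ℚ (K i₀)] [IsGalois ℚ (K i₁)] (Φ : ∀ i, CMType (K i)) (hnd₀ : IsNondegenerate (Φ i₀))
    (hnd₁ : IsNondegenerate (Φ i₁)) {x : ℂ} (hx₀ : x ∈ normalClosure ℚ (K i₀) ℂ)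
    (hx₁ : x ∈ normalClosure ℚ (K i₁) ℂ) (hx : starRingEnd ℂ x ≠ x) :
    CMAlgebra.cmFamilyRank Φ + Fintype.card I < (∑ i, cmTypeRank (Φ i)) + 1 ∧ ¬ CMAlgebra.IsNondegenerateFamily Φ := by
  obtain ⟨φ₀⟩ : Nonempty (K i₀ →+* ℂ) := inferInstance
  obtain ⟨φ₁⟩ : Nonempty (K i₁ →+* ℂ) := inferInstance
  haveI hN : ∀ j : I, @Normal ℚ ↥(normalClosure ℚ (K j) ℂ) _ _ (IntermediateField.algebra' _) :=
    normal_normalClosure_complex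
  letI : Algebra ℚ ↥(normalClosure ℚ (K i₀) ℂ ⊓ normalClosure ℚ (K i₁) ℂ) := IntermediateField.algebra' _
  haveI : FiniteDimensional ℚ ↥(normalClosure ℚ (K i₀) ℂ ⊓ normalClosure ℚ (K i₁) ℂ) :=
    finiteDimensional_of_le''' inf_le_left
  haveI : @Normal ℚ ↥(normalClosure ℚ (K i₀) ℂ ⊓ normalClosure ℚ (K i₁) ℂ) _ _ (IntermediateField.algebra' _) :=
    IntermediateField.normal_inf ℚ ℂ (normalClosure ℚ (K i₀) ℂ) (normalClosure ℚ (K i₁) ℂ)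
  refine cmFamilyRank_add_card_lt_of_common_subfield h01 Φ hnd₀ hnd₁
    (normalClosure ℚ (K i₀) ℂ ⊓ normalClosure ℚ (K i₁) ℂ)
    (fun τ τ' y hy => ringEquiv_comm_apply_of_abelian (k := K i₀) φ₀ τ τ' y hy.1) ⟨x, ⟨hx₀, hx₁⟩, hx⟩ φ₀ φ₁
    (fun y hy => normalClosure_le_range_of_normal φ₀ (show y ∈ normalClosure ℚ (K i₀) ℂ from hy.1))
    (fun y hy => normalClosure_le_range_of_normal φ₁ (show y ∈ normalClosure ℚ (K i₁) ℂ from hy.2))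

/-- **Kubota's Lemma 2 for FAMILIES, field-theoretic form: for ABELIAN CM fields `K_i` a family of CM types is
nondegenerate iff every member is nondegenerate and the Galois closures pairwise meet in TOTALLY REAL fields**
(`∏_i A_{Φ_i}` is stably nondegenerate iff every `A_{Φ_i}` is and no two fields share a CM subfield).
[cite: Kubota1965, §4 Lemma 2] [cite: Gordon1999HodgeAVSurvey, §3 Theorem, 7.5 and 9.4.1] -/
theorem isNondegenerateFamily_iff_of_abelian [∀ i, IsAbelianGalois ℚ (K i)] (Φ : ∀ i, CMType (K i)) :
    CMAlgebra.IsNondegenerateFamily Φ ↔ (∀ i, IsNondegenerate (Φ i)) ∧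
      ∀ i j, i ≠ j → ∀ x : ℂ, x ∈ normalClosure ℚ (K i) ℂ → x ∈ normalClosure ℚ (K j) ℂ → starRingEnd ℂ x = x := by
  refine ⟨fun h => ⟨fun i => h.isNondegenerate i, fun i j hij x hxi hxj => ?_⟩,
    fun h => (isNondegenerateFamily_iff_forall_of_pairwise_conj_apply_eq Φ h.2).2 h.1⟩
  by_contra hx
  exact (not_isNondegenerateFamily_of_abelian_of_conj_apply_ne hij Φ (h.isNondegenerate i) (h.isNondegenerate j)
    hxi hxj hx).2 h

/-- **Contrapositive display**: abelian CM fields, nondegenerate members, degenerate family ⟹ two of the fields share a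
non-real element (their intersection is a CM field). [cite: Kubota1965, §4 Lemma 2] [cite: Gordon1999HodgeAVSurvey, 7.5] -/
theorem exists_conj_apply_ne_of_not_isNondegenerateFamily_of_abelian [∀ i, IsAbelianGalois ℚ (K i)]
    (Φ : ∀ i, CMType (K i)) (hnd : ∀ i, IsNondegenerate (Φ i)) (h : ¬ CMAlgebra.IsNondegenerateFamily Φ) :
    ∃ i j, i ≠ j ∧ ∃ x : ℂ, x ∈ normalClosure ℚ (K i) ℂ ∧ x ∈ normalClosure ℚ (K j) ℂ ∧ starRingEnd ℂ x ≠ x := by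
  by_contra hne
  refine h ((isNondegenerateFamily_iff_of_abelian Φ).2 ⟨hnd, fun i j hij x hxi hxj => ?_⟩)
  by_contra hx
  exact hne ⟨i, j, hij, x, hxi, hxj, hx⟩

omit [DecidableEq I] in
/-- **Cyclotomic fields with a common level divisor `d ≥ 3`**: `K_{i₀} = ℚ(ζ_N)`, `K_{i₁} = ℚ(ζ_M)` (`i₀ ≠ i₁`) with
`d ∣ N`, `d ∣ M`, `3 ≤ d` both contain the abelian CM field `ℚ(ζ_d)` (embedded by b04/b27's
`CyclotomicSlice.exists_ringHom_cyclotomicField_apply_eq_pow`), so every family with `Φ_{i₀}`, `Φ_{i₁}` nondegenerate has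
non-additive rank and is DEGENERATE — e.g. `ℚ(ζ_5)` and `ℚ(ζ_15)`, `ℚ(ζ_7)` and `ℚ(ζ_21)`, `ℚ(ζ_9)` and `ℚ(ζ_{12})`; contrast
the COPRIME levels of `IndependentCMFieldsHodge`. [cite: Kubota1965, §4 Lemma 2] [cite: Gordon1999HodgeAVSurvey, 7.5–7.7] -/
theorem not_isNondegenerateFamily_of_isCyclotomicExtension_of_dvd {i₀ i₁ : I} (h01 : i₀ ≠ i₁) {d N M : ℕ}
    (hd : 3 ≤ d) [NeZero N] [NeZero M] (hN : d ∣ N) (hM : d ∣ M) [IsCyclotomicExtension {N} ℚ (K i₀)]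
    [IsCyclotomicExtension {M} ℚ (K i₁)] (Φ : ∀ i, CMType (K i)) (hnd₀ : IsNondegenerate (Φ i₀))
    (hnd₁ : IsNondegenerate (Φ i₁)) :
    CMAlgebra.cmFamilyRank Φ + Fintype.card I < (∑ i, cmTypeRank (Φ i)) + 1 ∧ ¬ CMAlgebra.IsNondegenerateFamily Φ := by
  haveI : NeZero d := ⟨by omega⟩
  haveI : NeZero ((d : ℕ) : ℚ) := ⟨Nat.cast_ne_zero.2 (NeZero.ne d)⟩
  haveI : IsCyclotomicExtension {d} ℚ (CyclotomicField d ℚ) := CyclotomicField.isCyclotomicExtension d ℚ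
  haveI : IsAbelianGalois ℚ (CyclotomicField d ℚ) := IsCyclotomicExtension.isAbelianGalois {d} ℚ _
  haveI : IsCMField (CyclotomicField d ℚ) :=
    IsCyclotomicExtension.Rat.isCMField (CyclotomicField d ℚ) (S := ({d} : Set ℕ)) ⟨d, rfl, by omega⟩
  obtain ⟨a, ha⟩ := hN
  obtain ⟨b, hb⟩ := hM
  obtain ⟨j₀, -⟩ := CyclotomicSlice.exists_ringHom_cyclotomicField_apply_eq_pow
    (IsCyclotomicExtension.zeta_spec N ℚ (K i₀)) (m' := d) (d := a) ha
  obtain ⟨j₁, -⟩ := CyclotomicSlice.exists_ringHom_cyclotomicField_apply_eq_pow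
    (IsCyclotomicExtension.zeta_spec M ℚ (K i₁)) (m' := d) (d := b) hb
  exact cmFamilyRank_add_card_lt_of_abelianCM_subfield h01 j₀ j₁ Φ hnd₀ hnd₁

end Fields

/-! ### Geometry: the Hodge conjecture on all products, or an exceptional Hodge class -/

section Geometry

variable {I : Type} {K : I → Type} [∀ i, Field (K i)] [∀ i, NumberField (K i)] [∀ i, IsCMField (K i)] [Fintype I]
  [DecidableEq I] [Nonempty I] {Φ : ∀ i, CMType (K i)}
variable {A : I → AbelianVariety ℂ} {ι : ∀ i, 𝓞 (K i) →+* End (A i)}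
  {θ : ∀ i, K i →+* Module.End ℂ (complexBetti (A i).X 1)}

/-- **The Hodge conjecture and `B• = D•` on every `∏_i A_i^{k_i}`** (every `⨁_{j<N} A_{π j}`) for realisations `A_i` of
NONDEGENERATE CM types of CM fields whose Galois closures pairwise meet in totally real fields — arbitrary CM fields,
UNCONDITIONALLY; for abelian fields this is exactly the nondegenerate case. [cite: Gordon1999HodgeAVSurvey, §3 Theorem and 10.10] -/
theorem hodgeConjectureFor_prod_of_pairwise_conj_apply_eq (hnd : ∀ i, IsNondegenerate (Φ i))
    (hreal : ∀ i j, i ≠ j → ∀ x : ℂ, x ∈ normalClosure ℚ (K i) ℂ → x ∈ normalClosure ℚ (K j) ℂ →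
      starRingEnd ℂ x = x)
    (hA : ∀ i, IsCMTypeRealisation (Φ i) (A i) (ι i) (θ i)) {N : ℕ} (π : Fin N → I) :
    HodgeConjectureFor (⨁ fun j : Fin N => A (π j)).dim (⨁ fun j : Fin N => A (π j)).X ∧
      ∀ m : ℕ, hodgeClassSpan (⨁ fun j : Fin N => A (π j)).dim (⨁ fun j : Fin N => A (π j)).X m =
        divisorClassesSpan (⨁ fun j : Fin N => A (π j)).X (⨁ fun j : Fin N => A (π j)).dim m :=
  have h := (isNondegenerateFamily_iff_forall_of_pairwise_conj_apply_eq Φ hreal).2 hnd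
  ⟨h.hodgeConjectureFor_prod hA π, fun m => h.hodgeClassSpan_prod_eq_divisorClassesSpan hA π m⟩

/-- **Abelian CM fields: the Hodge conjecture on every `∏_i A_i^{k_i}` from the field-theoretic criterion** (members
nondegenerate, pairwise real intersections). [cite: Gordon1999HodgeAVSurvey, §3 Theorem and 10.10]
[cite: Kubota1965, §4 Lemma 2] -/
theorem hodgeConjectureFor_prod_of_abelian [∀ i, IsAbelianGalois ℚ (K i)]
    (h : (∀ i, IsNondegenerate (Φ i)) ∧
      ∀ i j, i ≠ j → ∀ x : ℂ, x ∈ normalClosure ℚ (K i) ℂ → x ∈ normalClosure ℚ (K j) ℂ → starRingEnd ℂ x = x)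
    (hA : ∀ i, IsCMTypeRealisation (Φ i) (A i) (ι i) (θ i)) {N : ℕ} (π : Fin N → I) :
    HodgeConjectureFor (⨁ fun j : Fin N => A (π j)).dim (⨁ fun j : Fin N => A (π j)).X :=
  ((isNondegenerateFamily_iff_of_abelian Φ).2 h).hodgeConjectureFor_prod hA π

/-- **The dichotomy for simple, pairwise non-isogenous CM abelian varieties with CM by ABELIAN CM fields and
NONDEGENERATE types**: some product `∏_i A_i^{k_i}` carries an exceptional Hodge class (rational, of type `(m,m)`, outside
`Dᵐ ⊗ ℂ`) iff two of the fields share a non-real element — e.g. `ℚ(ζ_5)`- and `ℚ(ζ_15)`-CM factors (always), never for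
`ℚ(ζ_7)` and `ℚ(ζ_9)`. [cite: Gordon1999HodgeAVSurvey, 7.5–7.7] [cite: Deligne1982HodgeCycles, §4] [cite: Kubota1965, §4 Lemma 2] -/
theorem exists_exceptional_prod_iff_of_abelian [∀ i, IsAbelianGalois ℚ (K i)] (hnd : ∀ i, IsNondegenerate (Φ i))
    (hA : ∀ i, IsCMTypeRealisation (Φ i) (A i) (ι i) (θ i)) (hS : ∀ i, (A i).IsSimple)
    (hniso : ∀ i j, i ≠ j → ¬ AbelianVariety.IsIsogenous (A i) (A j)) :
    (∃ (N : ℕ) (π : Fin N → I) (m : ℕ) (c : complexBetti (⨁ fun j : Fin N => A (π j)).X (2 * m)),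
        IsRationalClass c ∧
        IsOfHodgeType (⨁ fun j : Fin N => A (π j)).dim (⨁ fun j : Fin N => A (π j)).X (2 * m) m m c ∧
        c ∉ divisorClassesSpan (⨁ fun j : Fin N => A (π j)).X (⨁ fun j : Fin N => A (π j)).dim m) ↔
      ∃ i j, i ≠ j ∧ ∃ x : ℂ, x ∈ normalClosure ℚ (K i) ℂ ∧ x ∈ normalClosure ℚ (K j) ℂ ∧ starRingEnd ℂ x ≠ x := by
  have hsep := CMAlgebra.isSeparatingFamily_of_isSimple_of_pairwise_not_isIsogenous hA hS hniso
  constructor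
  · rintro ⟨N, π, m, c, hcQ, hcH, hcD⟩
    refine exists_conj_apply_ne_of_not_isNondegenerateFamily_of_abelian Φ hnd fun h => ?_
    exact h.not_exists_exceptional_prod hA π m ⟨c, hcQ, hcH, hcD⟩
  · rintro ⟨i, j, hij, x, hxi, hxj, hx⟩
    exact CMAlgebra.exists_exceptional_prod_of_not_isNondegenerateFamily hsep
      (not_isNondegenerateFamily_of_abelian_of_conj_apply_ne hij Φ (hnd i) (hnd j) hxi hxj hx).2 hA

omit [DecidableEq I] in
/-- **Nested abelian CM fields carry exceptional classes**: simple, pairwise non-isogenous `A_i` with nondegenerate types,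
`K_{i₀}` abelian over `ℚ` embedding into `K_{i₁}` (`i₀ ≠ i₁`; e.g. `ℚ(ζ_N) ⊆ ℚ(ζ_M)`, `N ∣ M`) ⟹ some `∏_i A_i^{k_i}`
carries an exceptional Hodge class. [cite: Gordon1999HodgeAVSurvey, 7.5–7.7] [cite: Kubota1965, §4 Lemma 2] -/
theorem exists_exceptional_prod_of_ringHom_of_abelian {i₀ i₁ : I} (h01 : i₀ ≠ i₁) [IsAbelianGalois ℚ (K i₀)]
    (e : K i₀ →+* K i₁) (hnd₀ : IsNondegenerate (Φ i₀)) (hnd₁ : IsNondegenerate (Φ i₁))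
    (hA : ∀ i, IsCMTypeRealisation (Φ i) (A i) (ι i) (θ i)) (hS : ∀ i, (A i).IsSimple)
    (hniso : ∀ i j, i ≠ j → ¬ AbelianVariety.IsIsogenous (A i) (A j)) :
    ∃ (N : ℕ) (π : Fin N → I) (m : ℕ) (c : complexBetti (⨁ fun j : Fin N => A (π j)).X (2 * m)),
      IsRationalClass c ∧
      IsOfHodgeType (⨁ fun j : Fin N => A (π j)).dim (⨁ fun j : Fin N => A (π j)).X (2 * m) m m c ∧
      c ∉ divisorClassesSpan (⨁ fun j : Fin N => A (π j)).X (⨁ fun j : Fin N => A (π j)).dim m :=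
  CMAlgebra.exists_exceptional_prod_of_not_isNondegenerateFamily
    (CMAlgebra.isSeparatingFamily_of_isSimple_of_pairwise_not_isIsogenous hA hS hniso)
    (not_isNondegenerateFamily_of_ringHom_of_abelian h01 e Φ hnd₀ hnd₁) hA

omit [DecidableEq I] in
/-- **Cyclotomic fields with a common level divisor `d ≥ 3` carry exceptional classes**: simple, pairwise non-isogenous
`A_i` with nondegenerate types, `A_{i₀}` with CM by `ℚ(ζ_N)`, `A_{i₁}` by `ℚ(ζ_M)`, `d ∣ N`, `d ∣ M`, `3 ≤ d` ⟹ some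
`∏_i A_i^{k_i}` carries an exceptional Hodge class (rational `(m,m)`, outside `Dᵐ ⊗ ℂ`).
[cite: Gordon1999HodgeAVSurvey, 7.5–7.7] [cite: Kubota1965, §4 Lemma 2] -/
theorem exists_exceptional_prod_of_isCyclotomicExtension_of_dvd {i₀ i₁ : I} (h01 : i₀ ≠ i₁) {d N M : ℕ}
    (hd : 3 ≤ d) [NeZero N] [NeZero M] (hN : d ∣ N) (hM : d ∣ M) [IsCyclotomicExtension {N} ℚ (K i₀)]
    [IsCyclotomicExtension {M} ℚ (K i₁)] (hnd₀ : IsNondegenerate (Φ i₀)) (hnd₁ : IsNondegenerate (Φ i₁))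
    (hA : ∀ i, IsCMTypeRealisation (Φ i) (A i) (ι i) (θ i)) (hS : ∀ i, (A i).IsSimple)
    (hniso : ∀ i j, i ≠ j → ¬ AbelianVariety.IsIsogenous (A i) (A j)) :
    ∃ (N' : ℕ) (π : Fin N' → I) (m : ℕ) (c : complexBetti (⨁ fun j : Fin N' => A (π j)).X (2 * m)),
      IsRationalClass c ∧
      IsOfHodgeType (⨁ fun j : Fin N' => A (π j)).dim (⨁ fun j : Fin N' => A (π j)).X (2 * m) m m c ∧
      c ∉ divisorClassesSpan (⨁ fun j : Fin N' => A (π j)).X (⨁ fun j : Fin N' => A (π j)).dim m :=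
  CMAlgebra.exists_exceptional_prod_of_not_isNondegenerateFamily
    (CMAlgebra.isSeparatingFamily_of_isSimple_of_pairwise_not_isIsogenous hA hS hniso)
    (not_isNondegenerateFamily_of_isCyclotomicExtension_of_dvd h01 hd hN hM Φ hnd₀ hnd₁).2 hA

end Geometry

end Summit.HodgeConjecture.CorCM

end
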